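import Literature.NumberTheory.GaloisRepresentations.SplitsCompletelyCriteria
import Literature.NumberTheory.GaloisRepresentations.FrobeniusDensityTheorem
import Mathlib.NumberTheory.RamificationInertia.Galois
import HarnessLib

/-!
# Base change of complete splitting: `l` split in `K/ℚ` ⟹ every `v ∣ l` of `F` splits in `F · K`

Topic `Literature/NumberTheory/NumberFields`; a *proofs* file (theorems only, no definitions, no
named facts).  Let `K/ℚ` be a finite Galois extension in which the rational prime `l` splits
completely, `F` a number field and `N = F · K` a compositum (a number field, Galois over `F`,
generated over `F` by the image of `K`).  Then every finite place `v ∣ l` of `F` splits completely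
in `N` (`mem_splitPrimes_of_splitsCompletely`).  Proof (Neukirch, *Algebraic Number Theory*, I §9,
Prop. (9.1)–(9.4) and Exercise 3, p. 59 — decomposition groups are functorial; Marcus, *Number
Fields*, Ch. 4, Thm. 31: "if `P` splits completely in `K` then the primes of `F` above `P` split
completely in `FK`"): the restriction `Gal(N/F) → Gal(K/ℚ)`, `σ ↦ σ|_K`, is injective
(`N = F · K`) and carries the decomposition group of a prime `𝔔` of `N` into that of `𝔔 ∩ K`,
which is trivial because `l` splits completely in the Galois extension `K/ℚ` (orbit–stabiliser:
`[K : ℚ]` primes above `l`); so all decomposition groups above `v` in `Gal(N/F)` are trivial, i.e.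
`e(𝔔|v) f(𝔔|v) = 1` (the fundamental identity in the Galois case, Mathlib
`Ideal.ncard_primesOver_mul_ramificationIdxIn_mul_inertiaDegIn`).

This is the bookkeeping "`E = E₀ · E_a · E_b · E_c` […] in which each place of `V₀ ∪ V₁ ∪ V₂`
splits" (from "each rational prime lying below a place of `V₀ ∪ V₁ ∪ V₂` splits in
`E_a · E_b · E_c`") in Allen–Calegari–Caraiani–Gee–Helm–Le Hung–Newton–Scholze–Taylor–Thorne,
proof of Thm. 6.1.1 (arXiv:1812.09999, p. 89), joining the rational currency of
`QuadraticFields/ImaginaryQuadraticPrescribedSplitting` (`SplitsCompletely E_a l`, via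
`SplitsCompletelyCriteria.splitsCompletely_of_ncard_primesOver_eq_two`) to the `F`-level currency
`splitPrimes F E` of `SplitPrimesDisjointness(Absolute)`.

* `MulAction.orbit_eq_primesOver`, `MulAction.stabilizer_eq_bot_of_ncard_primesOver_eq_card` — for a
  finite Galois group `G` of `B/A`: the orbit of a prime above `p` is the set of primes above `p`,
  and the stabilisers (decomposition groups) are trivial as soon as there are `|G|` such primes;
* `stabilizer_eq_bot_of_splitsCompletely` — trivial decomposition groups above a completely split
  `l` in a Galois `K/ℚ`;
* `mem_splitPrimes_of_forall_stabilizer_eq_bot` — conversely, trivial decomposition groups above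
  `v` in a Galois `N/F` mean `v ∈ splitPrimes F N`;
* `mem_splitPrimes_of_splitsCompletely` — the base change;
* §5 the unramified analogue (Marcus Ch. 4 Thm. 31, first half): `exists_restrictHom`,
  `inertia_eq_bot_of_isUnramifiedIn_span`, `isUnramifiedIn_of_forall_inertia_eq_bot` and
  `isUnramifiedIn_of_isUnramifiedIn_span` — `l` unramified in `K` ⟹ every `v ∣ l` of `F` is
  unramified in `N = F · K` (inertia groups in place of decomposition groups).

## References

* J. Neukirch, *Algebraic Number Theory*, Springer 1999, Ch. I §9, Prop. (9.1)–(9.4).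
  [NeukirchANT1999]
* D. A. Marcus, *Number Fields*, 2nd ed., Springer 2018, Ch. 4, Thm. 31 and Cor. [Marcus2018]
* [ACCGHLNSTT2023] P. B. Allen et al., *Potential automorphy over CM fields*, Ann. of Math. 197
  (2023), §6.5, proof of Thm. 6.1.1 (p. 89 of arXiv:1812.09999).
-/

noncomputable section

open NumberField IsDedekindDomain Ideal

open scoped Pointwise Classical

namespace Literature.NumberTheory.NumberFields

open Literature.NumberTheory.GaloisRepresentations

/-! ## §1. Orbits and stabilisers of primes under a finite Galois group -/

section Galois

variable {A B G : Type*} [CommRing A] [CommRing B] [Algebra A B] [Group G] [Finite G]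
  [MulSemiringAction G B] [SMulCommClass G A B] [Algebra.IsInvariant A B G]

/-- **The orbit of a prime above `p` under the Galois group is the set of all primes above `p`**
(transitivity, Mathlib `Ideal.exists_smul_eq_of_isGaloisGroup` /
`Algebra.IsInvariant.exists_smul_of_under_eq`).  Neukirch I (9.1). [cite: NeukirchANT1999, Ch. I §9 Prop. (9.1)] -/
theorem MulAction.orbit_eq_primesOver {p : Ideal A} {P : Ideal B} (hP : P ∈ p.primesOver B) :
    MulAction.orbit G P = p.primesOver B := by
  haveI := hP.1
  haveI := hP.2
  ext Q
  constructor
  · rintro ⟨σ, rfl⟩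
    exact ⟨Ideal.IsPrime.smul σ, ⟨by rw [Ideal.under_smul]; exact hP.2.over⟩⟩
  · intro hQ
    haveI := hQ.1
    haveI := hQ.2
    obtain ⟨σ, hσ⟩ := Algebra.IsInvariant.exists_smul_of_under_eq A B G P Q
      (hP.2.over.symm.trans hQ.2.over)
    exact ⟨σ, hσ.symm⟩

/-- **`|G|` primes above `p` force trivial decomposition groups**: if there are `Nat.card G`
primes of `B` above `p` then the stabiliser of each of them in `G` is trivial (orbit–stabiliser).
[folklore] -/
theorem MulAction.stabilizer_eq_bot_of_ncard_primesOver_eq_card {p : Ideal A} {P : Ideal B}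
    (hP : P ∈ p.primesOver B) (h : (p.primesOver B).ncard = Nat.card G) :
    MulAction.stabilizer G P = ⊥ := by
  have hidx : (MulAction.stabilizer G P).index = Nat.card G := by
    rw [MulAction.index_stabilizer, MulAction.orbit_eq_primesOver hP, h]
  have hmul := (MulAction.stabilizer G P).index_mul_card
  rw [hidx] at hmul
  have hcard : Nat.card (MulAction.stabilizer G P) = 1 :=
    Nat.eq_of_mul_eq_mul_left Nat.card_pos (hmul.trans (mul_one _).symm)
  exact (Subgroup.card_eq_one.1 hcard)

end Galois

/-! ## §2. A completely split `l` in a Galois `K/ℚ` has trivial decomposition groups -/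

section Rational

variable {K : Type*} [Field K] [NumberField K] [IsGalois ℚ K]

/-- **Trivial decomposition groups above a completely split prime**: if the rational prime `l`
splits completely in the finite Galois extension `K/ℚ`, the stabiliser in `Gal(K/ℚ)` of every
prime of `K` above `l` is trivial (there are `[K : ℚ] = |Gal(K/ℚ)|` such primes).  Neukirch I
(9.3): `Z_𝔓 = 1 ⟺ 𝔭` is totally split. [cite: NeukirchANT1999, Ch. I §9 Prop. (9.3)] -/
theorem stabilizer_eq_bot_of_splitsCompletely {l : ℕ} (hl : l.Prime) (hK : SplitsCompletely K l)
    {P : Ideal (𝓞 K)} (hP : P ∈ (Ideal.span {(l : ℤ)}).primesOver (𝓞 K)) :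
    MulAction.stabilizer (K ≃ₐ[ℚ] K) P = ⊥ :=
  MulAction.stabilizer_eq_bot_of_ncard_primesOver_eq_card hP
    ((ncard_primesOver_eq_finrank_of_splitsCompletely hl hK).trans
      (IsGalois.card_aut_eq_finrank ℚ K).symm)

end Rational

/-! ## §3. Trivial decomposition groups mean complete splitting -/

section NumberField

variable {F N : Type*} [Field F] [NumberField F] [Field N] [NumberField N] [Algebra F N]
  [IsGalois F N]

/-- **Trivial decomposition groups above `v` in a Galois `N/F` mean that `v` splits completely**:
if the stabiliser in `Gal(N/F)` of every prime `𝔔 ∣ v` of `N` is trivial then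
`e(𝔔|v) = f(𝔔|v) = 1` for all `𝔔 ∣ v` (there are then `|Gal(N/F)|` primes above `v`, and
`Σ e f = [N : F]`), i.e. `v ∈ splitPrimes F N`.  Neukirch I (9.3).
[cite: NeukirchANT1999, Ch. I §9 Prop. (9.3)] -/
theorem mem_splitPrimes_of_forall_stabilizer_eq_bot (v : HeightOneSpectrum (𝓞 F))
    (h : ∀ 𝔔 ∈ v.asIdeal.primesOver (𝓞 N), MulAction.stabilizer (N ≃ₐ[F] N) 𝔔 = ⊥) :
    v ∈ splitPrimes F N := by
  haveI : IsGaloisGroup (N ≃ₐ[F] N) (𝓞 F) (𝓞 N) := IsGaloisGroup.of_isFractionRing _ _ _ F N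
  haveI := v.isPrime
  obtain ⟨𝔔, h𝔔max, h𝔔over⟩ :=
    Ideal.exists_maximal_ideal_liesOver_of_isIntegral (S := 𝓞 N) v.asIdeal
  haveI := h𝔔max.isPrime
  haveI := h𝔔over
  have h𝔔 : 𝔔 ∈ v.asIdeal.primesOver (𝓞 N) := ⟨h𝔔max.isPrime, h𝔔over⟩
  -- `#{𝔔 ∣ v} = |Gal(N/F)|`
  have hncard : (v.asIdeal.primesOver (𝓞 N)).ncard = Nat.card (N ≃ₐ[F] N) := by
    rw [← MulAction.orbit_eq_primesOver (G := N ≃ₐ[F] N) h𝔔, ← MulAction.index_stabilizer,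
      h 𝔔 h𝔔, Subgroup.index_bot]
  -- so `e f = 1`
  have hfund := Ideal.ncard_primesOver_mul_ramificationIdxIn_mul_inertiaDegIn v.asIdeal (𝓞 N)
    (N ≃ₐ[F] N)
  rw [hncard] at hfund
  have hef : v.asIdeal.ramificationIdxIn (𝓞 N) * v.asIdeal.inertiaDegIn (𝓞 N) = 1 :=
    Nat.eq_of_mul_eq_mul_left Nat.card_pos (hfund.trans (mul_one _).symm)
  have he : v.asIdeal.ramificationIdxIn (𝓞 N) = 1 := Nat.eq_one_of_mul_eq_one_right hef
  have hf : v.asIdeal.inertiaDegIn (𝓞 N) = 1 := Nat.eq_one_of_mul_eq_one_left hef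
  refine ⟨?_, fun Q hQ => ?_⟩
  · rw [Algebra.isUnramifiedIn_iff_forall_ramificationIdx_eq_one]
    intro Q _ hQ
    rw [← Ideal.ramificationIdxIn_eq_ramificationIdx v.asIdeal Q (N ≃ₐ[F] N)]
    exact he
  · haveI := hQ.1
    haveI := hQ.2
    rw [← Ideal.inertiaDegIn_eq_inertiaDeg v.asIdeal Q (N ≃ₐ[F] N)]
    exact hf

end NumberField

/-! ## §4. Base change of complete splitting -/

section BaseChange

variable {F K N : Type*} [Field F] [NumberField F] [Field K] [NumberField K] [IsGalois ℚ K]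
  [Field N] [NumberField N] [Algebra F N] [Algebra K N] [IsGalois F N]

omit [NumberField F] [NumberField K] [IsGalois ℚ K] [NumberField N] [IsGalois F N] in
/-- **An automorphism of `N = F · K` over `F` fixing `K` pointwise is the identity.** [folklore] -/
theorem algEquiv_eq_one_of_forall_apply_algebraMap_eq
    (hgen : IntermediateField.adjoin F (Set.range (algebraMap K N)) = ⊤) (σ : N ≃ₐ[F] N)
    (hσ : ∀ x : K, σ (algebraMap K N x) = algebraMap K N x) : σ = 1 := by
  have hle : IntermediateField.adjoin F (Set.range (algebraMap K N)) ≤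
      IntermediateField.fixedField (Subgroup.zpowers σ) := by
    rw [IntermediateField.adjoin_le_iff]
    rintro _ ⟨x, rfl⟩
    have hz : Subgroup.zpowers σ ≤ MulAction.stabilizer (N ≃ₐ[F] N) (algebraMap K N x) :=
      (Subgroup.zpowers_le (G := N ≃ₐ[F] N)).2 (hσ x)
    exact (IntermediateField.mem_fixedField_iff _ _).2 fun g hg => hz hg
  rw [hgen, top_le_iff] at hle
  ext y
  have hy : y ∈ IntermediateField.fixedField (Subgroup.zpowers σ) := by
    rw [hle]
    exact IntermediateField.mem_top
  exact (IntermediateField.mem_fixedField_iff _ _).1 hy σ (Subgroup.mem_zpowers σ)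

/-- **Base change of complete splitting** (Marcus, *Number Fields*, Ch. 4 Thm. 31; Neukirch I §9).
Let `K/ℚ` be finite Galois, `F` a number field and `N ⊇ F` a number field, Galois over `F`,
generated over `F` by the image of a `ℚ`-embedding `K → N` (`N = F · K`).  If the rational prime
`l` splits completely in `K` then every finite place `v ∣ l` of `F` splits completely in `N`.
Proof: for a prime `𝔔 ∣ v` of `N` and `σ ∈ Gal(N/F)` with `σ 𝔔 = 𝔔`, the restriction
`σ|_K ∈ Gal(K/ℚ)` fixes `𝔔 ∩ K`, a prime above `l`, hence is trivial
(`stabilizer_eq_bot_of_splitsCompletely`); so `σ` fixes `K` and `F`, i.e. `σ = 1`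
(`algEquiv_eq_one_of_forall_apply_algebraMap_eq`); conclude by
`mem_splitPrimes_of_forall_stabilizer_eq_bot`.  In ACC+ 2023, proof of Thm. 6.1.1: each place of
`V₀ ∪ V₁ ∪ V₂` splits in `E = E₀ · E_a · E_b · E_c` because the rational primes below them split
in `E_a`, `E_b`, `E_c`.
[cite: Marcus2018, Ch. 4, Thm. 31] [cite: NeukirchANT1999, Ch. I §9 Prop. (9.1)–(9.4)]
[cite: ACCGHLNSTT2023, §6.5, proof of Thm. 6.1.1 (p. 89 of arXiv:1812.09999)] -/
theorem mem_splitPrimes_of_splitsCompletely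
    (hgen : IntermediateField.adjoin F (Set.range (algebraMap K N)) = ⊤)
    {l : ℕ} (hl : l.Prime) (hK : SplitsCompletely K l)
    (v : HeightOneSpectrum (𝓞 F)) (hv : ((l : ℕ) : 𝓞 F) ∈ v.asIdeal) :
    v ∈ splitPrimes F N := by
  -- the restriction `r : Gal(N/F) → Gal(K/ℚ)`, `σ ↦ σ|_K`
  let r : (N ≃ₐ[F] N) →* (K ≃ₐ[ℚ] K) :=
    { toFun := fun σ => AlgEquiv.restrictNormalHom K (σ.restrictScalars ℚ)
      map_one' := by
        have h1 : ((1 : N ≃ₐ[F] N).restrictScalars ℚ : N ≃ₐ[ℚ] N) = 1 := AlgEquiv.ext fun _ => rfl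
        rw [h1, map_one]
      map_mul' := fun σ τ => by
        have h1 : ((σ * τ).restrictScalars ℚ : N ≃ₐ[ℚ] N) =
            σ.restrictScalars ℚ * τ.restrictScalars ℚ := AlgEquiv.ext fun _ => rfl
        rw [h1, map_mul] }
  have hr : ∀ (σ : N ≃ₐ[F] N) (x : K), algebraMap K N (r σ x) = σ (algebraMap K N x) :=
    fun σ x => AlgEquiv.restrictNormal_commutes (σ.restrictScalars ℚ) K x
  refine mem_splitPrimes_of_forall_stabilizer_eq_bot v fun 𝔔 h𝔔 => ?_
  haveI := h𝔔.1
  haveI := h𝔔.2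
  -- the prime `P = 𝔔 ∩ K` above `l`
  set P : Ideal (𝓞 K) := 𝔔.under (𝓞 K) with hPdef
  have hlN : ((l : ℕ) : 𝓞 N) ∈ 𝔔 := by
    have h1 : ((l : ℕ) : 𝓞 F) ∈ 𝔔.under (𝓞 F) := h𝔔.2.over ▸ hv
    rw [Ideal.under_def, Ideal.mem_comap, map_natCast] at h1
    exact h1
  have hlK : ((l : ℕ) : 𝓞 K) ∈ P := by
    rw [hPdef, Ideal.under_def, Ideal.mem_comap, map_natCast]
    exact hlN
  have hPne : P ≠ ⊥ := fun h0 => by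
    rw [h0, Ideal.mem_bot, Nat.cast_eq_zero] at hlK
    exact hl.ne_zero hlK
  have hPl : P ∈ (Ideal.span {(l : ℤ)}).primesOver (𝓞 K) :=
    ⟨inferInstance, liesOver_span_of_natCast_mem_asIdeal hl ⟨P, inferInstance, hPne⟩ hlK⟩
  have hbot := stabilizer_eq_bot_of_splitsCompletely hl hK hPl
  -- `σ ∈ Stab(𝔔) ⟹ σ|_K ∈ Stab(P) = 1 ⟹ σ = 1`
  rw [Subgroup.eq_bot_iff_forall]
  intro σ hσ
  rw [MulAction.mem_stabilizer_iff] at hσ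
  have hmem : r σ ∈ MulAction.stabilizer (K ≃ₐ[ℚ] K) P := by
    rw [MulAction.mem_stabilizer_iff]
    ext x
    rw [Ideal.mem_pointwise_smul_iff_inv_smul_mem, hPdef, Ideal.under_def, Ideal.mem_comap,
      Ideal.mem_comap]
    have key : algebraMap (𝓞 K) (𝓞 N) ((r σ)⁻¹ • x) = σ⁻¹ • algebraMap (𝓞 K) (𝓞 N) x := by
      apply Subtype.ext
      change algebraMap K N (((r σ)⁻¹ • x : 𝓞 K) : K) = ((σ⁻¹ • algebraMap (𝓞 K) (𝓞 N) x : 𝓞 N) : N)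
      rw [RingOfIntegers.coe_galois_smul, RingOfIntegers.coe_galois_smul, ← map_inv, hr]
      rfl
    rw [key, ← Ideal.mem_pointwise_smul_iff_inv_smul_mem, hσ]
  rw [hbot, Subgroup.mem_bot] at hmem
  refine algEquiv_eq_one_of_forall_apply_algebraMap_eq hgen σ fun x => ?_
  rw [← hr, hmem]
  rfl

end BaseChange

/-! ## §5. Base change of unramifiedness -/

section Unramified

variable {F K N : Type*} [Field F] [NumberField F] [Field K] [NumberField K] [IsGalois ℚ K]
  [Field N] [NumberField N] [Algebra F N] [Algebra K N] [IsGalois F N]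

omit [IsGalois F N] in
/-- **The restriction `Gal(N/F) → Gal(K/ℚ)`, `σ ↦ σ|_K`** (`K/ℚ` normal): a group homomorphism
`r` with `r(σ)(x) = σ(x)` for `x ∈ K ⊆ N` (Mathlib `AlgEquiv.restrictNormalHom` after
restricting scalars to `ℚ`). [folklore] -/
theorem exists_restrictHom :
    ∃ r : (N ≃ₐ[F] N) →* (K ≃ₐ[ℚ] K),
      ∀ (σ : N ≃ₐ[F] N) (x : K), algebraMap K N (r σ x) = σ (algebraMap K N x) :=
  ⟨{ toFun := fun σ => AlgEquiv.restrictNormalHom K (σ.restrictScalars ℚ)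
     map_one' := by
       have h1 : ((1 : N ≃ₐ[F] N).restrictScalars ℚ : N ≃ₐ[ℚ] N) = 1 := AlgEquiv.ext fun _ => rfl
       rw [h1, map_one]
     map_mul' := fun σ τ => by
       have h1 : ((σ * τ).restrictScalars ℚ : N ≃ₐ[ℚ] N) =
           σ.restrictScalars ℚ * τ.restrictScalars ℚ := AlgEquiv.ext fun _ => rfl
       rw [h1, map_mul] },
    fun σ x => AlgEquiv.restrictNormal_commutes (σ.restrictScalars ℚ) K x⟩

omit [IsGalois ℚ K] in
/-- **Trivial inertia above an unramified prime** in `K/ℚ` (for any finite group of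
automorphisms: `|I(P)| = e(P|l) = 1`, Mathlib `Ideal.card_inertia_eq_ramificationIdxIn`).
Neukirch I (9.6). [cite: NeukirchANT1999, Ch. I §9 Prop. (9.6)] -/
theorem inertia_eq_bot_of_isUnramifiedIn_span [IsGalois ℚ K] {l : ℕ}
    (hK : Algebra.IsUnramifiedIn (𝓞 K) (Ideal.span {(l : ℤ)})) {P : Ideal (𝓞 K)}
    (hP : P ∈ (Ideal.span {(l : ℤ)}).primesOver (𝓞 K)) : P.inertia (K ≃ₐ[ℚ] K) = ⊥ := by
  haveI := hP.1
  haveI := hP.2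
  haveI : P.LiesOver (P.under ℤ) := ⟨rfl⟩
  apply Subgroup.eq_bot_of_card_eq
  rw [Ideal.card_inertia_eq_ramificationIdxIn (G := K ≃ₐ[ℚ] K) (P.under ℤ) P,
    Ideal.ramificationIdxIn_eq_ramificationIdx (P.under ℤ) P (K ≃ₐ[ℚ] K)]
  exact Ideal.ramificationIdx_eq_one_iff.mpr (hK P hP.1 hP.2)

omit [IsGalois F N] in
/-- **Trivial inertia groups above `v` in a Galois `N/F` mean that `v` is unramified in `N`**
(`|I(𝔔)| = e(𝔔|v)`). Neukirch I (9.6). [cite: NeukirchANT1999, Ch. I §9 Prop. (9.6)] -/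
theorem isUnramifiedIn_of_forall_inertia_eq_bot [IsGalois F N] (v : HeightOneSpectrum (𝓞 F))
    (h : ∀ 𝔔 ∈ v.asIdeal.primesOver (𝓞 N), 𝔔.inertia (N ≃ₐ[F] N) = ⊥) :
    Algebra.IsUnramifiedIn (𝓞 N) v.asIdeal := by
  haveI : IsGaloisGroup (N ≃ₐ[F] N) (𝓞 F) (𝓞 N) := IsGaloisGroup.of_isFractionRing _ _ _ F N
  haveI := v.isPrime
  rw [Algebra.isUnramifiedIn_iff_forall_ramificationIdx_eq_one]
  intro Q _ hQ
  rw [← Ideal.ramificationIdxIn_eq_ramificationIdx v.asIdeal Q (N ≃ₐ[F] N),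
    ← Ideal.card_inertia_eq_ramificationIdxIn (G := N ≃ₐ[F] N) v.asIdeal Q, h Q ⟨‹_›, hQ⟩,
    Subgroup.card_bot]

/-- **Base change of unramifiedness** (Marcus, *Number Fields*, Ch. 4 Thm. 31 and Cor.;
Neukirch I §9): with `K/ℚ` finite Galois, `F` a number field and `N = F · K` Galois over `F`
as in `mem_splitPrimes_of_splitsCompletely`, if the rational prime `l` is unramified in `K`
then every finite place `v ∣ l` of `F` is unramified in `N`: for `𝔔 ∣ v` and `σ` in the
inertia group `I(𝔔|v) ≤ Gal(N/F)`, the restriction `σ|_K` lies in `I(𝔔 ∩ K | l) = 1`, so `σ`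
fixes `K` and `F`, i.e. `σ = 1`.  In ACC+ 2023, proof of Thm. 6.1.1: "The prime `p` is
unramified in `E`" for `E = E₀ · E_a · E_b · E_c` (p. 89), from `p` unramified in `E₀` and in
`E_a · E_b · E_c`.
[cite: Marcus2018, Ch. 4, Thm. 31] [cite: NeukirchANT1999, Ch. I §9 Prop. (9.6)]
[cite: ACCGHLNSTT2023, §6.5, proof of Thm. 6.1.1 (p. 89 of arXiv:1812.09999)] -/
theorem isUnramifiedIn_of_isUnramifiedIn_span
    (hgen : IntermediateField.adjoin F (Set.range (algebraMap K N)) = ⊤)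
    {l : ℕ} (hl : l.Prime) (hK : Algebra.IsUnramifiedIn (𝓞 K) (Ideal.span {(l : ℤ)}))
    (v : HeightOneSpectrum (𝓞 F)) (hv : ((l : ℕ) : 𝓞 F) ∈ v.asIdeal) :
    Algebra.IsUnramifiedIn (𝓞 N) v.asIdeal := by
  obtain ⟨r, hr⟩ := exists_restrictHom (F := F) (K := K) (N := N)
  refine isUnramifiedIn_of_forall_inertia_eq_bot v fun 𝔔 h𝔔 => ?_
  haveI := h𝔔.1
  haveI := h𝔔.2
  -- the prime `P = 𝔔 ∩ K` above `l`
  set P : Ideal (𝓞 K) := 𝔔.under (𝓞 K) with hPdef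
  have hlN : ((l : ℕ) : 𝓞 N) ∈ 𝔔 := by
    have h1 : ((l : ℕ) : 𝓞 F) ∈ 𝔔.under (𝓞 F) := h𝔔.2.over ▸ hv
    rw [Ideal.under_def, Ideal.mem_comap, map_natCast] at h1
    exact h1
  have hlK : ((l : ℕ) : 𝓞 K) ∈ P := by
    rw [hPdef, Ideal.under_def, Ideal.mem_comap, map_natCast]
    exact hlN
  have hPne : P ≠ ⊥ := fun h0 => by
    rw [h0, Ideal.mem_bot, Nat.cast_eq_zero] at hlK
    exact hl.ne_zero hlK
  have hPl : P ∈ (Ideal.span {(l : ℤ)}).primesOver (𝓞 K) :=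
    ⟨inferInstance, liesOver_span_of_natCast_mem_asIdeal hl ⟨P, inferInstance, hPne⟩ hlK⟩
  have hbot := inertia_eq_bot_of_isUnramifiedIn_span hK hPl
  -- `σ ∈ I(𝔔) ⟹ σ|_K ∈ I(P) = 1 ⟹ σ = 1`
  rw [Subgroup.eq_bot_iff_forall]
  intro σ hσ
  rw [AddSubgroup.mem_inertia] at hσ
  have hmem : r σ ∈ P.inertia (K ≃ₐ[ℚ] K) := by
    rw [AddSubgroup.mem_inertia]
    intro y
    change algebraMap (𝓞 K) (𝓞 N) (r σ • y - y) ∈ 𝔔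
    rw [map_sub]
    have key : algebraMap (𝓞 K) (𝓞 N) (r σ • y) = σ • algebraMap (𝓞 K) (𝓞 N) y := by
      apply Subtype.ext
      change algebraMap K N ((r σ • y : 𝓞 K) : K) = ((σ • algebraMap (𝓞 K) (𝓞 N) y : 𝓞 N) : N)
      rw [RingOfIntegers.coe_galois_smul, RingOfIntegers.coe_galois_smul, hr]
      rfl
    rw [key]
    exact hσ _
  rw [hbot, Subgroup.mem_bot] at hmem
  refine algEquiv_eq_one_of_forall_apply_algebraMap_eq hgen σ fun x => ?_
  rw [← hr, hmem]
  rfl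

end Unramified

end Literature.NumberTheory.NumberFields

end
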